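import Mathlib
import HarnessLib
import Summits.HubbardSuperconductivity.HubbardSuperconductivity.Theorems.KLProgrammeKLRegimeEngineTowerBlockStepLev
import Summits.HubbardSuperconductivity.HubbardSuperconductivity.Theorems.KLProgrammeKLRegimeEngineV8E5PointAugment
import Summits.HubbardSuperconductivity.HubbardSuperconductivity.Theorems.KLProgrammeKLRegimeEngineV8E5BlockLabels
import Summits.HubbardSuperconductivity.HubbardSuperconductivity.Theorems.KLProgrammeKLRegimeFatOverlapCount
import Summits.HubbardSuperconductivity.HubbardSuperconductivity.Theorems.KLProgrammeKLRegimeSectorRadialAlignment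

/-!
# Route `KLProgramme` — ENGINE child gen 8 (stmt-HubbardSuperconductivity-20437 `KLRegimeEngineV17F2`), SKELETON v2 class #3, (RA-U) SUPPLIER part 1:
# the two PRESCRIBED one-step doors AT THE CARRIER GEOMETRY — normal covariance of a shell-supported symbol, POINT-AUGMENTED thin/fat families —
# plateau and parent facts discharged (cell gate-hubbard-kl, seat p5 g10; pen (R71e): p5 = owner of the (RA-U) supplier; memo RA-U-SUPPLY §3 (c) / §5)

The class-#3 open input (RA-U) is a levelled-norm law for the Wick carrier `W_Λ = e^{Δ_{C∞−C_Λ}}(effAction C_Λ V)` (…EngineV8E5Share) on the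
POINT-AUGMENTED anisotropic family of level `n−2`; its supplier is E1's block read-out run once more at the non-dyadic cutoff `Λ` with the DRESSED partial
slice `C_Λ = normalCovariance (s_Λ/(1+s_Λκ))` (memo RA-U-SUPPLY §5).  This file is the twin of E1's `…EngineTowerBlockStepLev` (p568996 §2 / p571169 at
the block geometry) for THAT geometry: the covariance is `normalCovariance L M p` for ANY symbol `p` supported in the shell `{ρ_K ≤ Λ_{J₁}}`
(`ρ_K = √(ω² + e_K²)`; the dressed slice at `Λ ∈ [Λ_n, Λ_{n−1}]` qualifies with `J₁ = n−2`, two levels of margin), the input pair is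
`(pointAugment (klAnisoFamily … (J₁−1)) e, pointAugmentFat (klAnisoFamily … (J₁−1)) (bgmFatMultiplier … (J₁−1)) e)` and the output family is
`pointAugment (klAnisoFamily … J′) e` (`2 ≤ J₁ ≤ J′`; the external momenta `e` become point legs on both sides):

* §1 the six geometry facts: `pointAugmentFat_mul_klAniso` (`hFF`), `pointAugment_klAniso_eq_zero_of_sum_eq_zero` (`hF0`),
  **`sum_pointAugment_klAniso_eq_one_of_normalCovariance_ne_zero`** (`hCpl`: a normal covariance of a shell-supported symbol lives in the augmented plateau;
  `normalCovariance_apply` + `sum_klAnisoFamily_eq_one_of_le` + `sum_pointAugment_eq_one_of_eq_one`), **`sum_pointAugment_klAniso_pred_eq_one_of_ne_zero`**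
  (`hF'pl`: thin output legs by the aniso nesting `sum_klAnisoFamily_pred_eq_one_of_klAnisoFamily_ne_zero`, point legs by `sum_pointAugment_eq_one_of_exists`),
  **`card_parentsLeg_pointAugment_le`** (parents count `36 + q₀`: a fine thin sector meets `≤ 27` coarse fat sectors (`card_overlap_klAniso_bgmFat_coarse_le`),
  a point leg meets `≤ 9` (`card_overlap_bgmFat_le_nine` + `card_filter_ne_zero_le_of_overlap`), either meets `≤ q₀` point legs);
* §2 **`carrierStep_ordersGe2_lev_le`** — orders ≥ 2 of `effAction (normalCovariance p) G − e^{Δ} G` with prescribed output legs, graded RHS in the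
  prescribed input sizes `B m′ Fc` of `G` at the augmented input family, step constants (`κ`, `α`, `(cr, cc)`, `ρ`, `θ < 1`) as named hypotheses
  (VERBATIM the shape of E1's `blockStep_ordersGe2_lev_le`, parents constant `36 + q₀`);
* §3 **`carrierStep_firstOrder_lev_le`** — first order `e^{Δ} G − G` likewise (binomial-prescribed RHS).
Consumers: the (RA-U) composition (next parts): `p := s_Λ/(1+s_Λκ)` with `A_p = 2` Gram data (k3c2-p2) transferred to the augmented pair by
…E5PointAugment §2, `G := klE5Input … (n−1)`, input sizes from the class-#1 MIXED rows, then the smearing by `C∞ − C_Λ` and E1's kit summation.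
Compositions of landed theorems; no definitions; nothing about the model is asserted beyond them; nothing asserts superconductivity.
-/

noncomputable section

namespace Summit.HubbardSuperconductivity.HubbardSuperconductivity.Theorems.KLRegimeSplit

set_option linter.dupNamespace false -- summit = problem name (single-conjunct summit), D-0017

open Real Finset Literature.MathematicalPhysics.QuantumLattice Literature.Probability.LatticeModels GrassmannAlgebra Matrix
open Literature.MathematicalPhysics.QuantumLattice.FermiRG
open Summit.HubbardSuperconductivity.HubbardSuperconductivity.Theorems.KLProgrammeLegKernels
open Summit.HubbardSuperconductivity.HubbardSuperconductivity.Theorems.KLRegimeWick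
open Summit.HubbardSuperconductivity.HubbardSuperconductivity.Theorems.EngineV8
open Summit.HubbardSuperconductivity.HubbardSuperconductivity.Theorems.TwoPointAssembly
open Summit.HubbardSuperconductivity.HubbardSuperconductivity.Theorems.TorusFourierL2
open Summit.HubbardSuperconductivity.HubbardSuperconductivity.Theorems.DispersionFlow

/-! ## §1 Geometry of the carrier step: plateau, nesting and parents for the point-augmented aniso pair -/

section Geometry

variable {L M : ℕ} [NeZero L] (β μ : ℝ) (K : TrigPolyC4v)

/-- `hFF` for the point-augmented pair of level `j`: `F̃⁺·F⁺ = F⁺` (`bgmFatMultiplier_mul_bgmMultiplier` lifted by `pointAugmentFat_mul_pointAugment`). [folklore] -/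
theorem pointAugmentFat_mul_klAniso (j : ℕ) {q₀ : ℕ} (e : Fin q₀ → FreqMomentum L M) (ω : Fin (sectorCount j + q₀)) (k : FreqMomentum L M) :
    pointAugmentFat (klAnisoFamily L M β μ K klE0 j) (bgmFatMultiplier L M klE0 β (nambuXiCT L μ K) j) e ω k *
        pointAugment (klAnisoFamily L M β μ K klE0 j) e ω k = pointAugment (klAnisoFamily L M β μ K klE0 j) e ω k :=
  pointAugmentFat_mul_pointAugment _ _ _ (fun ω k => bgmFatMultiplier_mul_bgmMultiplier (by norm_num [klE0]) β (nambuXiCT L μ K) j ω k) ω k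

omit [NeZero L] in
/-- `hF0` for the point-augmented thin family of level `j`: `Σ_ω F⁺_ω(k) = 0 ⇒ F⁺_ω(k) = 0`. [folklore] -/
theorem pointAugment_klAniso_eq_zero_of_sum_eq_zero (j : ℕ) {q₀ : ℕ} (e : Fin q₀ → FreqMomentum L M) (k : FreqMomentum L M)
    (h : ∑ ω, pointAugment (klAnisoFamily L M β μ K klE0 j) e ω k = 0) (ω : Fin (sectorCount j + q₀)) :
    pointAugment (klAnisoFamily L M β μ K klE0 j) e ω k = 0 :=
  pointAugment_eq_zero_of_sum_eq_zero _ _ (fun k hk ω => klAnisoFamily_eq_zero_of_sum_eq_zero β μ K klE0 j k hk ω) k h ω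

omit [NeZero L] in
/-- **`hCpl` at the carrier geometry**: a NORMAL covariance whose symbol is supported in the shell `{ρ_K ≤ Λ_{J₁}}` (`1 ≤ J₁`) has both legs of every
nonzero entry in the plateau of the point-augmented thin family of level `J₁−1` (the aniso plateau contains `{ρ_K ≤ Λ_{J₁}}`, and point augmentation
keeps it). [folklore] -/
theorem sum_pointAugment_klAniso_eq_one_of_normalCovariance_ne_zero {J₁ : ℕ} (hJ₁ : 1 ≤ J₁) {q₀ : ℕ} (e : Fin q₀ → FreqMomentum L M)
    (p : FreqMomentum L M × Fin 2 → ℂ)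
    (hp : ∀ ks, p ks ≠ 0 → Real.sqrt (matsubaraFreq β M ks.1.1 ^ 2 + nambuXiCT L μ K ks.1.2 ^ 2) ≤ klScale klE0 J₁)
    (X Y : HubbardFieldIdx L M) (h : normalCovariance L M p X Y ≠ 0) :
    ∑ ω, pointAugment (klAnisoFamily L M β μ K klE0 (J₁ - 1)) e ω X.1.1 = 1 ∧
      ∑ ω, pointAugment (klAnisoFamily L M β μ K klE0 (J₁ - 1)) e ω Y.1.1 = 1 := by
  have hXY : X.1 = Y.1 := by
    by_contra hne
    exact h (by rw [normalCovariance_apply, if_neg hne])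
  have hpX : p X.1 ≠ 0 := by
    intro h0
    apply h
    rw [normalCovariance_apply, if_pos hXY, h0, neg_zero]
    split_ifs <;> rfl
  have he : (0 : ℝ) < klE0 := by norm_num [klE0]
  have h1 : ∑ ω, klAnisoFamily L M β μ K klE0 (J₁ - 1) ω X.1.1 = 1 :=
    sum_klAnisoFamily_eq_one_of_le β μ K he (J₁ - 1) X.1.1 (by rw [Nat.sub_add_cancel hJ₁]; exact hp X.1 hpX)
  refine ⟨sum_pointAugment_eq_one_of_eq_one _ _ h1, ?_⟩
  rw [← hXY]
  exact sum_pointAugment_eq_one_of_eq_one _ _ h1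

omit [NeZero L] in
/-- **`hF'pl` at the carrier geometry**: the point-augmented thin family of level `J′ ≥ J₁` is supported in the plateau of the point-augmented thin
family of level `J₁−1` (`1 ≤ J₁`): thin legs by the aniso one-level nesting, point legs because the augmented plateau contains the points. [folklore] -/
theorem sum_pointAugment_klAniso_pred_eq_one_of_ne_zero {J₁ J' : ℕ} (hJ₁ : 1 ≤ J₁) (hJ' : J₁ ≤ J') {q₀ : ℕ} (e : Fin q₀ → FreqMomentum L M)
    (ω' : Fin (sectorCount J' + q₀)) (k : FreqMomentum L M) (h : pointAugment (klAnisoFamily L M β μ K klE0 J') e ω' k ≠ 0) :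
    ∑ ω, pointAugment (klAnisoFamily L M β μ K klE0 (J₁ - 1)) e ω k = 1 := by
  induction ω' using Fin.addCases with
  | left ω =>
    rw [pointAugment_castAdd] at h
    exact sum_pointAugment_eq_one_of_eq_one _ _ (sum_klAnisoFamily_pred_eq_one_of_klAnisoFamily_ne_zero β μ K hJ₁ hJ' ω k h)
  | right j =>
    rw [pointAugment_natAdd] at h
    have hj : e j = k := by
      by_contra hne
      exact h (if_neg hne)
    exact sum_pointAugment_eq_one_of_exists _ _ ⟨j, hj⟩

/-- **Parents count at the carrier geometry**: a leg label of the point-augmented thin family of level `J′` (thin sector or point, with spin and charge)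
meets — support overlap with the point-augmented FAT family of level `k`, `1 ≤ k ≤ J′`, equal spin and charge — at most `36 + q₀` coarse labels:
a fine thin sector meets `≤ 27` coarse fat sectors (`card_overlap_klAniso_bgmFat_coarse_le`) and `≤ q₀` fat points; a fine point meets `≤ 9` coarse fat
sectors (`card_overlap_bgmFat_le_nine`, `card_filter_ne_zero_le_of_overlap`) and `≤ q₀` fat points. [cite: BenfattoGiulianiMastropietro2006, §2.7 (2.71a)] -/
theorem card_parentsLeg_pointAugment_le {k J' : ℕ} (hk : 1 ≤ k) (hkJ : k ≤ J') {q₀ : ℕ} (e : Fin q₀ → FreqMomentum L M)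
    (ℓ'' : SectorLeg (sectorCount J' + q₀)) :
    (((univ.filter fun ℓ' : SectorLeg (sectorCount k + q₀) =>
        (∃ q : FreqMomentum L M, pointAugment (klAnisoFamily L M β μ K klE0 J') e ℓ''.1.1 q ≠ 0 ∧
          pointAugmentFat (klAnisoFamily L M β μ K klE0 k) (bgmFatMultiplier L M klE0 β (nambuXiCT L μ K) k) e ℓ'.1.1 q ≠ 0) ∧
        ℓ'.1.2 = ℓ''.1.2 ∧ ℓ'.2 = ℓ''.2).card : ℝ)) ≤ ((36 + q₀ : ℕ) : ℝ) := by
  classical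
  have he : (0 : ℝ) < klE0 := by norm_num [klE0]
  obtain ⟨m, rfl⟩ : ∃ m, k = m + 1 := ⟨k - 1, by omega⟩
  -- the sector-index component of the parents
  set S : Finset (Fin (sectorCount (m + 1) + q₀)) := univ.filter fun ω' =>
      ∃ q : FreqMomentum L M, pointAugment (klAnisoFamily L M β μ K klE0 J') e ℓ''.1.1 q ≠ 0 ∧
        pointAugmentFat (klAnisoFamily L M β μ K klE0 (m + 1)) (bgmFatMultiplier L M klE0 β (nambuXiCT L μ K) (m + 1)) e ω' q ≠ 0 with hS
  have hinj : (univ.filter fun ℓ' : SectorLeg (sectorCount (m + 1) + q₀) =>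
        (∃ q : FreqMomentum L M, pointAugment (klAnisoFamily L M β μ K klE0 J') e ℓ''.1.1 q ≠ 0 ∧
          pointAugmentFat (klAnisoFamily L M β μ K klE0 (m + 1)) (bgmFatMultiplier L M klE0 β (nambuXiCT L μ K) (m + 1)) e ℓ'.1.1 q ≠ 0) ∧
        ℓ'.1.2 = ℓ''.1.2 ∧ ℓ'.2 = ℓ''.2).card ≤ S.card := by
    refine Finset.card_le_card_of_injOn (fun ℓ' : SectorLeg (sectorCount (m + 1) + q₀) => ℓ'.1.1) (fun ℓ' hℓ' => ?_)
      (fun ℓ₁ h₁ ℓ₂ h₂ heq => ?_)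
    · simp only [mem_coe, mem_filter, mem_univ, true_and, hS] at hℓ' ⊢
      exact hℓ'.1
    · simp only [mem_coe, mem_filter, mem_univ, true_and] at h₁ h₂
      exact Prod.ext (Prod.ext heq (h₁.2.1.trans h₂.2.1.symm)) (h₁.2.2.trans h₂.2.2.symm)
  -- the old (fat-sector) parents
  set T : Finset (Fin (sectorCount (m + 1))) := univ.filter fun ω =>
      ∃ q : FreqMomentum L M, pointAugment (klAnisoFamily L M β μ K klE0 J') e ℓ''.1.1 q ≠ 0 ∧
        bgmFatMultiplier L M klE0 β (nambuXiCT L μ K) (m + 1) ω q ≠ 0 with hT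
  have hsplit : S ⊆ (T.map (Fin.castAddEmb q₀)) ∪ (univ : Finset (Fin q₀)).map (Fin.natAddEmb (sectorCount (m + 1))) := by
    intro ω hω
    obtain ⟨q, hA, hq⟩ := (mem_filter.1 hω).2
    rcases mem_map_castAdd_or_natAdd (N := sectorCount (m + 1)) (q := q₀) ω with h | h
    · obtain ⟨ω₀, -, rfl⟩ := mem_map.1 h
      refine mem_union_left _ (mem_map.2 ⟨ω₀, mem_filter.2 ⟨mem_univ _, ⟨q, hA, ?_⟩⟩, rfl⟩)
      simpa only [Fin.castAddEmb_apply, pointAugmentFat_castAdd] using hq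
    · exact mem_union_right _ h
  have hS_le : S.card ≤ T.card + q₀ :=
    (card_le_card hsplit).trans ((card_union_le _ _).trans
      (Nat.add_le_add (by rw [card_map]) (by rw [card_map, card_univ, Fintype.card_fin])))
  -- the fat-sector parents: `≤ 27` if the fine leg is a thin sector, `≤ 9` if it is a point
  have hT_le : T.card ≤ 36 := by
    rcases mem_map_castAdd_or_natAdd (N := sectorCount J') (q := q₀) ℓ''.1.1 with h1 | h1
    · obtain ⟨ω'', -, hω''⟩ := mem_map.1 h1
      calc T.card ≤ ((univ : Finset (Fin (sectorCount (m + 1)))).filter (fun ω₂ : Fin (sectorCount (m + 1)) =>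
              ∃ q : FreqMomentum L M, klAnisoFamily L M β μ K klE0 J' ω'' q ≠ 0 ∧
                bgmFatMultiplier L M klE0 β (nambuXiCT L μ K) (m + 1) ω₂ q ≠ 0)).card := by
            refine card_le_card fun ω hω => mem_filter.2 ⟨mem_univ _, ?_⟩
            obtain ⟨q, hA, hq⟩ := (mem_filter.1 hω).2
            refine ⟨q, ?_, hq⟩
            rw [← hω''] at hA
            simpa only [Fin.castAddEmb_apply, pointAugment_castAdd] using hA
        _ ≤ 27 := card_overlap_klAniso_bgmFat_coarse_le he β μ K hkJ ω''
        _ ≤ 36 := by norm_num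
    · obtain ⟨j'', -, hj''⟩ := mem_map.1 h1
      have hρ₀ := card_overlap_bgmFat_le_nine (L := L) (M := M) (e₀ := klE0) (β := β) (μ := μ) (K := K) m
      calc T.card ≤ ((univ : Finset (Fin (sectorCount (m + 1)))).filter fun ω =>
              bgmFatMultiplier L M klE0 β (nambuXiCT L μ K) (m + 1) ω (e j'') ≠ 0).card := by
            refine card_le_card fun ω hω => mem_filter.2 ⟨mem_univ _, ?_⟩
            obtain ⟨q, hA, hq⟩ := (mem_filter.1 hω).2
            rw [← hj''] at hA
            simp only [Fin.natAddEmb_apply, pointAugment_natAdd] at hA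
            have hjq : e j'' = q := by
              by_contra hne
              exact hA (by rw [if_neg hne])
            rwa [hjq]
        _ ≤ 9 := card_filter_ne_zero_le_of_overlap _ (fun ω => by convert hρ₀ ω) (e j'')
        _ ≤ 36 := by norm_num
  have hfin := hinj.trans (hS_le.trans (Nat.add_le_add_right hT_le q₀))
  exact_mod_cast hfin

end Geometry

/-! ## §2 Orders ≥ 2 of the carrier step, levelled track -/

section Doors

variable {L M : ℕ} [NeZero L] [NeZero M]

/-- **ORDERS ≥ 2 OF THE CARRIER STEP, PRESCRIBED LEGS (the graded prescribed door at the (RA-U) geometry).**  Covariance = `normalCovariance p` of ANY symbol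
supported in the shell `{ρ_K ≤ Λ_{J₁}}` (e.g. the dressed partial slice `s_Λ/(1+s_Λκ)`, `Λ ∈ [Λ_n, Λ_{n−1}]`, `J₁ = n−2`); input families = the
POINT-AUGMENTED pair of level `J₁−1` at the external momenta `e`; output family = the point-augmented thin family of level `J′ ≥ J₁` (`2 ≤ J₁`);
child relation = support overlap (parents count `36 + q₀`); `G` even without constant part; step constants (`κ`, `α`, `(cr, cc)`, `ρ`, `θ < 1`) as named
hypotheses; prescribed input sizes `B m′ Fc` of `G` at the augmented input family; output legs `J` prescribed to `τ″`, pinned leg `p_1 ∉ J`.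
[cite: BenfattoGiulianiMastropietro2006, §2.8 (2.82)-(2.84); Lemma 2.5 (2.98)] -/
theorem carrierStep_ordersGe2_lev_le {β : ℝ} (hβ : 0 < β) (μ : ℝ) (K : TrigPolyC4v) {J₁ J' : ℕ} (hJ₁ : 2 ≤ J₁) (hJ' : J₁ ≤ J') {q₀ : ℕ} (e : Fin q₀ → FreqMomentum L M)
    (p : FreqMomentum L M × Fin 2 → ℂ)
    (hp : ∀ ks, p ks ≠ 0 → Real.sqrt (matsubaraFreq β M ks.1.1 ^ 2 + nambuXiCT L μ K ks.1.2 ^ 2) ≤ klScale klE0 J₁)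
    (G : HubbardGrassmann L M) (hG : G ∈ evenPart ℂ (HubbardFieldIdx L M)) (hG0 : constPart ℂ G = 0)
    {κ : ℝ} (hκ : 0 < κ)
    (hGB : IsGramBoundedR ((sectorSubMatrix L M β (pointAugmentFat (klAnisoFamily L M β μ K klE0 (J₁ - 1)) (bgmFatMultiplier L M klE0 β (nambuXiCT L μ K) (J₁ - 1)) e)).transpose *
      normalCovariance L M p *
        sectorSubMatrix L M β (pointAugmentFat (klAnisoFamily L M β μ K klE0 (J₁ - 1)) (bgmFatMultiplier L M klE0 β (nambuXiCT L μ K) (J₁ - 1)) e)) κ)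
    (B : ℕ → ℕ → ℝ) (hB0 : ∀ m' Fc, 0 ≤ B m' Fc)
    (hB : ∀ (m' Fc : ℕ) (E : Finset (Fin (2 * m' + 1 + 1))) (τ : Fin (2 * m' + 1 + 1) → SectorLeg (sectorCount (J₁ - 1) + q₀))
      (q : Fin (2 * m' + 1 + 1)), q ∈ E → E.card = Fc + 1 → ∀ y : SpaceTimeIdx L M,
        imagTimeWeight β M ^ (2 * m' + 1) *
          ∑ σ ∈ univ.filter (fun σ : Fin (2 * m' + 1 + 1) → SectorLeg (sectorCount (J₁ - 1) + q₀) => ∀ e ∈ E, σ e = τ e),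
            ∑ x ∈ univ.filter (fun x : Fin (2 * m' + 1 + 1) → SpaceTimeIdx L M => x q = y),
              ‖sectorisedKernel L M β (pointAugment (klAnisoFamily L M β μ K klE0 (J₁ - 1)) e) G (2 * m' + 1 + 1) σ x‖ ≤ B (m' + 1) Fc)
    {α : ℝ} (hα : 0 < α)
    (hrow : ∀ X, ∑ Y, ‖((sectorSubMatrix L M β (pointAugmentFat (klAnisoFamily L M β μ K klE0 (J₁ - 1)) (bgmFatMultiplier L M klE0 β (nambuXiCT L μ K) (J₁ - 1)) e)).transpose *
        normalCovariance L M p *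
          sectorSubMatrix L M β (pointAugmentFat (klAnisoFamily L M β μ K klE0 (J₁ - 1)) (bgmFatMultiplier L M klE0 β (nambuXiCT L μ K) (J₁ - 1)) e)) X Y‖ ≤ α)
    (hcol : ∀ Y, ∑ X, ‖((sectorSubMatrix L M β (pointAugmentFat (klAnisoFamily L M β μ K klE0 (J₁ - 1)) (bgmFatMultiplier L M klE0 β (nambuXiCT L μ K) (J₁ - 1)) e)).transpose *
        normalCovariance L M p *
          sectorSubMatrix L M β (pointAugmentFat (klAnisoFamily L M β μ K klE0 (J₁ - 1)) (bgmFatMultiplier L M klE0 β (nambuXiCT L μ K) (J₁ - 1)) e)) X Y‖ ≤ α)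
    {ρ : ℝ} (hρ : 0 < ρ)
    (hθ : Real.exp 1 * α * normV (SpaceTimeIdx L M × SectorLeg (sectorCount (J₁ - 1) + q₀)) κ ρ
      (fun m' => ((36 + q₀ : ℕ) : ℝ) ^ 0 * (imagTimeWeight β M * B m' 0)) / κ ^ 2 < 1)
    {cr cc : ℝ} (hcc0 : 0 ≤ cc)
    (hrow' : ∀ X'', ∑ X', ‖(sectorAnalysisMatrix L M β (pointAugment (klAnisoFamily L M β μ K klE0 J') e) *
        sectorSubMatrix L M β (pointAugmentFat (klAnisoFamily L M β μ K klE0 (J₁ - 1)) (bgmFatMultiplier L M klE0 β (nambuXiCT L μ K) (J₁ - 1)) e)) X'' X'‖ ≤ cr)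
    (hcol' : ∀ X', ∑ X'', ‖(sectorAnalysisMatrix L M β (pointAugment (klAnisoFamily L M β μ K klE0 J') e) *
        sectorSubMatrix L M β (pointAugmentFat (klAnisoFamily L M β μ K klE0 (J₁ - 1)) (bgmFatMultiplier L M klE0 β (nambuXiCT L μ K) (J₁ - 1)) e)) X'' X'‖ ≤ cc)
    {N₀ : ℕ} (hN₀ : 2 ≤ N₀) {m : ℕ} (p_1 : Fin (m + 1)) (J : Finset (Fin (m + 1))) (hp_1 : p_1 ∉ J)
    (τ'' : Fin (m + 1) → SectorLeg (sectorCount J' + q₀)) (w'' : SpaceTimeIdx L M × SectorLeg (sectorCount J' + q₀)) :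
    ∑ X'' ∈ univ.filter (fun X'' : Fin (m + 1) → SpaceTimeIdx L M × SectorLeg (sectorCount J' + q₀) => X'' p_1 = w'' ∧ ∀ j ∈ J, (X'' j).2 = τ'' j),
        ‖kernel ℂ (ExteriorAlgebra.map (Matrix.toLin' (sectorAnalysisMatrix L M β (pointAugment (klAnisoFamily L M β μ K klE0 J') e)))
          (effAction ℂ (normalCovariance L M p) G -
            gaussConv ℂ (normalCovariance L M p) G)) (m + 1) X''‖ ≤
      cr * cc ^ m *
        (∑ n ∈ Ico 2 N₀, (κ⁻¹ ^ (m + 1) * κ⁻¹ ^ (2 * (n - 1)) * (α ^ (n - 1) * Real.exp n)) *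
            ∑ δ ∈ (Fintype.piFinset fun _ : Fin n => range (Fintype.card (SpaceTimeIdx L M × SectorLeg (sectorCount (J₁ - 1) + q₀)) / 2 + 1)) with
                m + 1 + 2 * (n - 1) ≤ ∑ a, 2 * δ a,
              ∑ pf : J → Fin n, ((∏ j, ((2 * δ (pf j) : ℕ) : ℝ)) / ((∑ a, 2 * δ a : ℕ) : ℝ) ^ J.card) *
                ∏ a, (Real.exp 3 * κ) ^ (2 * δ a) *
                  (((36 + q₀ : ℕ) : ℝ) ^ (univ.filter fun j : J => pf j = a).card *
                    (imagTimeWeight β M * B (δ a) (univ.filter fun j : J => pf j = a).card)) +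
          ρ⁻¹ ^ (m + 1) * (Real.exp 1 * normV (SpaceTimeIdx L M × SectorLeg (sectorCount (J₁ - 1) + q₀)) κ ρ
              (fun m' => ((36 + q₀ : ℕ) : ℝ) ^ 0 * (imagTimeWeight β M * B m' 0))) *
            (Real.exp 1 * α * normV (SpaceTimeIdx L M × SectorLeg (sectorCount (J₁ - 1) + q₀)) κ ρ
                (fun m' => ((36 + q₀ : ℕ) : ℝ) ^ 0 * (imagTimeWeight β M * B m' 0)) / κ ^ 2) ^ (N₀ - 1) /
            (1 - Real.exp 1 * α * normV (SpaceTimeIdx L M × SectorLeg (sectorCount (J₁ - 1) + q₀)) κ ρ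
                (fun m' => ((36 + q₀ : ℕ) : ℝ) ^ 0 * (imagTimeWeight β M * B m' 0)) / κ ^ 2)) := by
  classical
  exact sum_filter_norm_sectorAnalysis_effAction_sub_gaussConv_le_graded_prescribed_of_plateau hβ _ _
    (pointAugmentFat_mul_klAniso β μ K (J₁ - 1) e) (pointAugment_klAniso_eq_zero_of_sum_eq_zero β μ K (J₁ - 1) e) _ G hG hG0 _
    (fun X Y hXY => sum_pointAugment_klAniso_eq_one_of_normalCovariance_ne_zero β μ K (by omega) e p hp X Y hXY)
    (fun ω' k hne => sum_pointAugment_klAniso_pred_eq_one_of_ne_zero β μ K (by omega) hJ' e ω' k hne)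
    (fun ω'' ω' => ∃ k : FreqMomentum L M, pointAugment (klAnisoFamily L M β μ K klE0 J') e ω'' k ≠ 0 ∧
      pointAugmentFat (klAnisoFamily L M β μ K klE0 (J₁ - 1)) (bgmFatMultiplier L M klE0 β (nambuXiCT L μ K) (J₁ - 1)) e ω' k ≠ 0)
    (fun X'' X' hne => overlap_of_sectorAnalysis_mul_sectorSub_ne_zero β _ _ X'' X' hne)
    (by positivity) (fun ℓ'' => card_parentsLeg_pointAugment_le β μ K (k := J₁ - 1) (by omega) (by omega) e ℓ'')
    hκ hGB B hB0 hB hα hrow hcol hρ hθ hcc0 hrow' hcol' hN₀ p_1 J hp_1 τ'' w''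

/-! ## §3 First order of a block step, levelled track -/

/-- **FIRST ORDER OF THE CARRIER STEP, PRESCRIBED LEGS (the binomial prescribed door at the (RA-U) geometry).**  Same covariance class, families, child
relation and parents count; even `G`; degree `2(q+1)` output with legs `J` prescribed to `τ″`, pinned leg `i ∉ J`. [cite: BenfattoGiulianiMastropietro2006, §2.8 (2.80)] -/
theorem carrierStep_firstOrder_lev_le {β : ℝ} (hβ : 0 < β) (μ : ℝ) (K : TrigPolyC4v) {J₁ J' : ℕ} (hJ₁ : 2 ≤ J₁) (hJ' : J₁ ≤ J') {q₀ : ℕ} (e : Fin q₀ → FreqMomentum L M)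
    (p : FreqMomentum L M × Fin 2 → ℂ)
    (hp : ∀ ks, p ks ≠ 0 → Real.sqrt (matsubaraFreq β M ks.1.1 ^ 2 + nambuXiCT L μ K ks.1.2 ^ 2) ≤ klScale klE0 J₁)
    (G : HubbardGrassmann L M) (hG : G ∈ evenPart ℂ (HubbardFieldIdx L M))
    {κ : ℝ} (hκ : 0 ≤ κ)
    (hGB : IsGramBoundedR ((sectorSubMatrix L M β (pointAugmentFat (klAnisoFamily L M β μ K klE0 (J₁ - 1)) (bgmFatMultiplier L M klE0 β (nambuXiCT L μ K) (J₁ - 1)) e)).transpose *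
      normalCovariance L M p *
        sectorSubMatrix L M β (pointAugmentFat (klAnisoFamily L M β μ K klE0 (J₁ - 1)) (bgmFatMultiplier L M klE0 β (nambuXiCT L μ K) (J₁ - 1)) e)) κ)
    (B : ℕ → ℕ → ℝ) (hB0 : ∀ m' Fc, 0 ≤ B m' Fc)
    (hB : ∀ (m' Fc : ℕ) (E : Finset (Fin (2 * m' + 1 + 1))) (τ : Fin (2 * m' + 1 + 1) → SectorLeg (sectorCount (J₁ - 1) + q₀))
      (q : Fin (2 * m' + 1 + 1)), q ∈ E → E.card = Fc + 1 → ∀ y : SpaceTimeIdx L M,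
        imagTimeWeight β M ^ (2 * m' + 1) *
          ∑ σ ∈ univ.filter (fun σ : Fin (2 * m' + 1 + 1) → SectorLeg (sectorCount (J₁ - 1) + q₀) => ∀ e ∈ E, σ e = τ e),
            ∑ x ∈ univ.filter (fun x : Fin (2 * m' + 1 + 1) → SpaceTimeIdx L M => x q = y),
              ‖sectorisedKernel L M β (pointAugment (klAnisoFamily L M β μ K klE0 (J₁ - 1)) e) G (2 * m' + 1 + 1) σ x‖ ≤ B (m' + 1) Fc)
    {cr cc : ℝ} (hcc0 : 0 ≤ cc)
    (hrow' : ∀ X'', ∑ X', ‖(sectorAnalysisMatrix L M β (pointAugment (klAnisoFamily L M β μ K klE0 J') e) *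
        sectorSubMatrix L M β (pointAugmentFat (klAnisoFamily L M β μ K klE0 (J₁ - 1)) (bgmFatMultiplier L M klE0 β (nambuXiCT L μ K) (J₁ - 1)) e)) X'' X'‖ ≤ cr)
    (hcol' : ∀ X', ∑ X'', ‖(sectorAnalysisMatrix L M β (pointAugment (klAnisoFamily L M β μ K klE0 J') e) *
        sectorSubMatrix L M β (pointAugmentFat (klAnisoFamily L M β μ K klE0 (J₁ - 1)) (bgmFatMultiplier L M klE0 β (nambuXiCT L μ K) (J₁ - 1)) e)) X'' X'‖ ≤ cc)
    {q : ℕ} (i : Fin (2 * q + 1 + 1)) (J : Finset (Fin (2 * q + 1 + 1))) (hi : i ∉ J)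
    (τ'' : Fin (2 * q + 1 + 1) → SectorLeg (sectorCount J' + q₀)) (w'' : SpaceTimeIdx L M × SectorLeg (sectorCount J' + q₀)) :
    ∑ X'' ∈ univ.filter (fun X'' : Fin (2 * q + 1 + 1) → SpaceTimeIdx L M × SectorLeg (sectorCount J' + q₀) =>
        X'' i = w'' ∧ ∀ j ∈ J, (X'' j).2 = τ'' j),
        ‖kernel ℂ (ExteriorAlgebra.map (Matrix.toLin' (sectorAnalysisMatrix L M β (pointAugment (klAnisoFamily L M β μ K klE0 J') e)))
          (gaussConv ℂ (normalCovariance L M p) G - G)) (2 * q + 1 + 1) X''‖ ≤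
      cr * cc ^ (2 * q + 1) *
        ∑ m' ∈ range (Fintype.card (SpaceTimeIdx L M × SectorLeg (sectorCount (J₁ - 1) + q₀)) / 2 + 1), (if q + 1 < m' then
          ((((2 * (q + 1)).factorial : ℝ))⁻¹ * ((∏ j ∈ univ.filter (fun j : Fin (2 * (q + 1)) => j ∉ J), (2 * m' - (j : ℕ)) : ℕ) : ℝ)) *
            ((2 * m' : ℕ) : ℝ) ^ J.card * κ ^ (2 * m' - 2 * (q + 1)) * (((36 + q₀ : ℕ) : ℝ) ^ J.card * (imagTimeWeight β M * B m' J.card)) else 0) := by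
  classical
  exact sum_filter_norm_sectorAnalysis_gaussConv_sub_le_binomial_prescribed_of_plateau hβ _ _
    (pointAugmentFat_mul_klAniso β μ K (J₁ - 1) e) (pointAugment_klAniso_eq_zero_of_sum_eq_zero β μ K (J₁ - 1) e) _ G hG _
    (fun X Y hXY => sum_pointAugment_klAniso_eq_one_of_normalCovariance_ne_zero β μ K (by omega) e p hp X Y hXY)
    (fun ω' k hne => sum_pointAugment_klAniso_pred_eq_one_of_ne_zero β μ K (by omega) hJ' e ω' k hne)
    (fun ω'' ω' => ∃ k : FreqMomentum L M, pointAugment (klAnisoFamily L M β μ K klE0 J') e ω'' k ≠ 0 ∧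
      pointAugmentFat (klAnisoFamily L M β μ K klE0 (J₁ - 1)) (bgmFatMultiplier L M klE0 β (nambuXiCT L μ K) (J₁ - 1)) e ω' k ≠ 0)
    (fun X'' X' hne => overlap_of_sectorAnalysis_mul_sectorSub_ne_zero β _ _ X'' X' hne)
    (by positivity) (fun ℓ'' => card_parentsLeg_pointAugment_le β μ K (k := J₁ - 1) (by omega) (by omega) e ℓ'')
    hκ hGB B hB0 hB hcc0 hrow' hcol' i J hi τ'' w''

end Doors

end Summit.HubbardSuperconductivity.HubbardSuperconductivity.Theorems.KLRegimeSplit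

end
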